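import Summits.QuantumFields.BalabanUV.T4Continuum.Support.NE7FlatGradientLetterBlockDiv
import HarnessLib

/-!
# NE7FlatSupLetterCubeDivForm — THE FLAT SUP LETTER WITH A DIVERGENCE-FORM SOURCE ON A CUBE: for a bond field `Z` vanishing off `cube c R` with `‖curl₁ Z‖ ≤ B`,
# `flatDiv Z = flatDiv g + s` (`g` a 1-form off `cube c (R+1)`, `‖g‖ ≤ Gb`, `‖s‖ ≤ S′`): **`‖Z x κ‖ ≤ C·(R+1)·(B + S′) + C′·(1 + log(R+1))·Gb`** (`sup_letter_cube_divForm`)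

Cell `pub-balaban`, rung (B)+1 sub-cell t4; row-NE7b owner lineage `b2b-balaban-t4-ne7b-p1` (gen 155).  **INTERFACE REQUEST NE7→NE7b, stub (S-h) PART (b)** of t4-ne7-p1 g108
([NE7P1-G108-INBOX-3]: «THE FLAT SUP LETTER WITH A DIVERGENCE-FORM SOURCE (your `gradient_letter_cube_blockDiv` ONE DERIVATIVE DOWN)», signature as printed there) — the flat input of the
road's route to [Balaban1985Variational] Thm 1 (10) TYPE up to a logarithm: in a comb gauge every component `f = B_{μν}` of the curvature solves `Δf = flatDiv q + r`, and with the cutoff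
`χ` of `cube x₀ R` the 1-form `Z := ∇^{flat}(χf)` has `curl Z = 0`, `flatDiv Z = Δ(χf) = flatDiv g + s` (`g := χ•q + 2f•∇χ`, `s := χr − ∇χ·q − fΔχ`); THIS letter then bounds `Z = ∇(χf)`.
MECHANISM (gen 154's, one derivative down).  Green representation of the real functional `f∘Z_κ` on `cube c (R+3)` (`PoissonInterior.green_rep`); `−ΔZ_κ = Σ_ν[curl(y;ν,κ) −
curl(y−e_ν;ν,κ)] + [flatDiv Z(y+e_κ) − flatDiv Z(y)]` (`NE7FlatGradientLetterCompact.lapVec_eq_curl_div`); every term is a lattice DERIVATIVE of data, moved onto `G₀` by one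
`sum_shift`: the curl and `s` parts meet `|∇G₀| ≤ C₁nrm^{1−d}` over the cube (`≤ C(R+1)`, `sum_cube_inv_nrm_sub_le`), the `flatDiv g` part is moved once more onto `∇∇G₀`
(`G₀_diff2_bound`, `≤ C₂nrm^{−d}`) over the logarithmic sum (`NE7FlatGradientLetterBlockDiv.sum_cube_inv_nrm_pow_d_le`, `one_add_posLog_le`); `s` vanishes off `cube c (R+2)`
automatically (`= flatDiv Z − flatDiv g` there).
WHAT ([folklore]; 0 def, 0 sorry).  §1 shift∕support bookkeeping and the logarithmic row sum seen from a point of the cube; §2 **`sup_letter_cube_divForm`** (`d ≥ 3`, EXACTLY the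
requested signature: `∃ C C′ ≥ 0`, `∀ c R Z` off `cube c R`, `∀ B ≥ 0` bounding `‖curlAt 1 Z z μ ν‖` (`μ ≠ ν`), `∀ g` off `cube c (R+1)` with `‖g x λ‖ ≤ Gb`, `∀ s` with `‖s x‖ ≤ S′`,
`flatDiv Z = flatDiv g + s` ⟹ `∀ x κ, ‖Z x κ‖ ≤ C·(R+1)·(B + S′) + C′·(1 + Real.log (R+1))·Gb`).  The interior (cutoff-inside) scalar form of the same estimate is this lineage's
`NE7FlatInteriorGradientDivForm.interior_gradient_divForm`.
HONEST FRAMING (page 1): flat `ℤ^d` potential theory, [folklore]; constants inherit lit1's existential Green-function constants; nothing of Bałaban's asserted; the covariant assembly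
(S-h)(c) and (10) TYPE are NOT proved here; NE3∕NE7 NOT proved; row NE7b NOT PRINTED ∕ NOT PROVED; spine count = dagwriter's call; finite T⁴ rung (B)+1 — NOT infinite volume, NOT mass
gap, NOT BetaPertH, NOT Clay.
-/

set_option autoImplicit false

open scoped BigOperators Matrix.Norms.L2Operator
open Finset

namespace Summit.QuantumFields.BalabanUV.T4Continuum.NE7FlatSupLetterCubeDivForm

open Literature.MathematicalPhysics.QuantumFieldTheory.Balaban1983to89
open B7Prop1Explicit (Site e)
open T4AveragingDeficitWall (curlAt)
open BlockAveragePushDirSplit (flat)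
open NE3CoercivityScaling (flatDiv)
open NE3SmoothLiftCurl (curlAt_flat_eq)
open Literature.Probability.LatticeModels (latticeLaplacianZd latticeLaplacianZd_def)
open Beta.PoissonInterior (cube mem_cube cube_mono nrm nrm_pos G₀ G₀_diff_bound G₀_diff2_bound green_rep sum_cube_inv_nrm_pow_le sum_shift supNorm supNorm_neg
  supNorm_single_one nrm_shift_ge_half)
open NE7FlatGradientLetterCompact (lapVec_eq_curl_div curlAt_flat_diag lap_dual_apply mem_cube_succ_of_add_e sum_cube_inv_nrm_sub_le)
open NE7FlatGradientLetterBlockDiv (sum_cube_inv_nrm_pow_d_le one_add_posLog_le)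

noncomputable section

variable {d : ℕ} {n : Type*} [Fintype n] [DecidableEq n]

/-! ## §1 Support bookkeeping and the logarithmic row sum seen from a point of the cube -/

omit [Fintype n] [DecidableEq n] in
/-- `x ∈ cube c R ⟹ x − e_μ ∈ cube c (R+1)` and `x + e_μ ∈ cube c (R+1)`. [folklore] -/
theorem sub_e_mem_cube_succ {c x : Site d} {R : ℕ} (h : x ∈ cube c R) (μ : Fin d) :
    x - e μ ∈ cube c (R + 1) ∧ x + e μ ∈ cube c (R + 1) :=
  ⟨Beta.PoissonInterior.sub_mem_cube_succ h (supNorm_single_one μ), Beta.PoissonInterior.add_mem_cube_succ h (supNorm_single_one μ)⟩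

/-- the flat curl of a field vanishing off `cube c R` vanishes off `cube c (R+1)`. [folklore] -/
theorem curlAt_flat_eq_zero_off (Z : Site d → Fin d → Matrix n n ℂ) {c : Site d} {R : ℕ} (hZ : ∀ x, x ∉ cube c R → Z x = 0)
    {y : Site d} (hy : y ∉ cube c (R + 1)) (μ ν : Fin d) : curlAt (flat (d := d) (n := n)) Z y μ ν = 0 := by
  have h0 : Z y = 0 := hZ y fun h => hy (cube_mono (Nat.le_succ R) h)
  have h1 : Z (y + e μ) = 0 := hZ _ fun h => hy (mem_cube_succ_of_add_e h)
  have h2 : Z (y + e ν) = 0 := hZ _ fun h => hy (mem_cube_succ_of_add_e h)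
  rw [curlAt_flat_eq, h0, h1, h2]; simp

omit [Fintype n] [DecidableEq n] in
/-- the flat divergence of a field vanishing off `cube c R` vanishes off `cube c (R+1)`. [folklore] -/
theorem flatDiv_eq_zero_off (Z : Site d → Fin d → Matrix n n ℂ) {c : Site d} {R : ℕ} (hZ : ∀ x, x ∉ cube c R → Z x = 0)
    {y : Site d} (hy : y ∉ cube c (R + 1)) : flatDiv Z y = 0 := by
  have h0 : Z y = 0 := hZ y fun h => hy (cube_mono (Nat.le_succ R) h)
  have h1 : ∀ μ : Fin d, Z (y - e μ) = 0 := fun μ => hZ _ fun h => hy (by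
    have h' := (sub_e_mem_cube_succ h μ).2; rwa [sub_add_cancel] at h')
  simp only [flatDiv, h0, Pi.zero_apply, zero_sub]
  rw [Finset.sum_eq_zero]; intro μ _; rw [h1 μ]; simp

omit [Fintype n] [DecidableEq n] in
/-- **THE LOGARITHMIC ROW SUM SEEN FROM A POINT OF THE CUBE**: for `x ∈ cube c R′`, `Σ_{y ∈ cube c R′} nrm(x − y)^{−d} ≤ 1 + 2d·3^{d−1}·(1 + log⁺(2R′))`. [folklore] -/
theorem sum_cube_inv_nrm_pow_d_sub_le (hd : 3 ≤ d) (c x : Site d) (R' : ℕ) (hx : x ∈ cube c R') :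
    ∑ y ∈ cube c R', 1 / nrm (x - y) ^ d ≤ 1 + 2 * d * 3 ^ (d - 1) * (1 + Real.posLog ((2 * R' : ℕ) : ℝ)) := by
  have hd0 : 0 < d := by omega
  have hinj : Set.InjOn (fun y : Site d => x - y) ↑(cube c R') := fun a _ b _ h => sub_right_injective h
  rw [← Finset.sum_image (f := fun z : Site d => 1 / nrm z ^ d) hinj]
  have hsub : (cube c R').image (fun y => x - y) ⊆ cube (0 : Site d) (2 * R') := by
    intro z hz
    rw [Finset.mem_image] at hz
    obtain ⟨y, hy, rfl⟩ := hz
    rw [mem_cube] at hx hy ⊢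
    intro i
    have h1 := hx i
    have h2 := hy i
    rw [Pi.zero_apply, sub_zero, Pi.sub_apply]
    calc |x i - y i| = |(x i - c i) - (y i - c i)| := by ring_nf
      _ ≤ |x i - c i| + |y i - c i| := abs_sub _ _
      _ ≤ (R' : ℤ) + (R' : ℤ) := add_le_add h1 h2
      _ = ((2 * R' : ℕ) : ℤ) := by push_cast; ring
  calc ∑ z ∈ (cube c R').image (fun y => x - y), 1 / nrm z ^ d
      ≤ ∑ z ∈ cube (0 : Site d) (2 * R'), 1 / nrm z ^ d :=
        Finset.sum_le_sum_of_subset_of_nonneg hsub fun z _ _ => one_div_nonneg.mpr (pow_nonneg (nrm_pos z).le _)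
    _ ≤ _ := sum_cube_inv_nrm_pow_d_le hd0 _

/-- `1 + log⁺(2R+6) ≤ 4·(1 + log(R+1))`. [folklore] -/
theorem one_add_posLog_two_mul_le (R : ℕ) : 1 + Real.posLog ((2 * (R + 3) : ℕ) : ℝ) ≤ 4 * (1 + Real.log ((R : ℝ) + 1)) := by
  have hR1 : (1 : ℝ) ≤ (R : ℝ) + 1 := by have : (0 : ℝ) ≤ R := Nat.cast_nonneg R; linarith
  have hlog0 : 0 ≤ Real.log ((R : ℝ) + 1) := Real.log_nonneg hR1
  have hx : (1 : ℝ) ≤ ((2 * (R + 3) : ℕ) : ℝ) := by exact_mod_cast (by omega : 1 ≤ 2 * (R + 3))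
  rw [Real.posLog_eq_log (by rw [abs_of_pos (by positivity)]; exact hx)]
  have h6 : ((2 * (R + 3) : ℕ) : ℝ) ≤ 6 * ((R : ℝ) + 1) := by push_cast; linarith
  have hle : Real.log ((2 * (R + 3) : ℕ) : ℝ) ≤ Real.log 6 + Real.log ((R : ℝ) + 1) := by
    rw [← Real.log_mul (by norm_num) (by positivity)]
    exact Real.log_le_log (by positivity) h6
  have hlog6 : Real.log 6 ≤ 3 := by
    have h := Real.log_le_sub_one_of_pos (show (0 : ℝ) < 6 / 16 by norm_num)
    have h2 : Real.log 6 = Real.log (6 / 16) + 4 * Real.log 2 := by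
      rw [Real.log_div (by norm_num) (by norm_num), show (16 : ℝ) = 2 ^ 4 by norm_num, Real.log_pow]; ring
    have hl2 : Real.log 2 ≤ 0.6931471808 := Real.log_two_lt_d9.le
    rw [h2]; nlinarith
  linarith

/-! ## §2 The sup letter with a divergence-form source -/

set_option maxHeartbeats 400000 in
/-- **THE FLAT SUP LETTER WITH A DIVERGENCE-FORM SOURCE, CUBE GEOMETRY** (`d ≥ 3`; INTERFACE REQUEST NE7→NE7b (S-h)(b), signature as requested): `∃ C C′ ≥ 0` (functions of `d`)
such that for every cube `cube c R`, every bond field `Z` vanishing off it, every `B ≥ 0` with `‖curlAt 1 Z z μ ν‖ ≤ B` (`μ ≠ ν`), every 1-form `g` vanishing off `cube c (R+1)` with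
`‖g x λ‖ ≤ Gb`, every `s` with `‖s x‖ ≤ S′`, and `flatDiv Z = flatDiv g + s` everywhere:
`‖Z x κ‖ ≤ C·(R+1)·(B + S′) + C′·(1 + log(R+1))·Gb` — no derivative on the curl∕`s` data (one power of the radius), the divergence-form part `g` at the price of a LOGARITHM. [folklore] -/
theorem sup_letter_cube_divForm (hd : 3 ≤ d) : ∃ C C' : ℝ, 0 ≤ C ∧ 0 ≤ C' ∧
    ∀ (c : Site d) (R : ℕ) (Z : Site d → Fin d → Matrix n n ℂ), (∀ x, x ∉ cube c R → Z x = 0) →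
      ∀ (B : ℝ), 0 ≤ B → (∀ (z : Site d) (μ ν : Fin d), μ ≠ ν → ‖curlAt (flat (d := d) (n := n)) Z z μ ν‖ ≤ B) →
      ∀ (g : Site d → Fin d → Matrix n n ℂ), (∀ x, x ∉ cube c (R + 1) → g x = 0) → ∀ (Gb : ℝ), (∀ (x : Site d) (lam : Fin d), ‖g x lam‖ ≤ Gb) →
      ∀ (s : Site d → Matrix n n ℂ) (S' : ℝ), (∀ x, ‖s x‖ ≤ S') →
      (∀ x, flatDiv Z x = flatDiv g x + s x) →
      ∀ (x : Site d) (κ : Fin d), ‖Z x κ‖ ≤ C * ((R : ℝ) + 1) * (B + S') + C' * (1 + Real.log ((R : ℝ) + 1)) * Gb := by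
  obtain ⟨C₁, hC₁, hG1⟩ := G₀_diff_bound hd
  obtain ⟨C₂, hC₂, hG2⟩ := G₀_diff2_bound hd
  have hd0 : 0 < d := by omega
  have hd1 : (1 : ℝ) ≤ d := by exact_mod_cast hd0
  -- the constants: row sum `1 + 2d3^{d−1}(2(R+2)+2) ≤ (1 + 2d3^{d−1})·6·(R+1)`; log sum `≤ (1 + 2d3^{d−1})·4·(1+log(R+1))`
  set A₀ : ℝ := 1 + 2 * d * 3 ^ (d - 1) with hA₀
  have hA₀0 : 0 ≤ A₀ := by positivity
  refine ⟨(d + 1) * C₁ * (6 * A₀), d * (2 ^ d * C₂) * (4 * A₀), by positivity, by positivity, ?_⟩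
  intro c R Z hZ B hB0 hB g hg Gb hGb s S' hs hdiv x κ
  have hGb0 : 0 ≤ Gb := (norm_nonneg _).trans (hGb x κ)
  have hS0 : 0 ≤ S' := (norm_nonneg _).trans (hs x)
  have hR0 : (0 : ℝ) ≤ R := Nat.cast_nonneg R
  have hlog0 : 0 ≤ Real.log ((R : ℝ) + 1) := Real.log_nonneg (by linarith)
  have hrhs0 : 0 ≤ (d + 1) * C₁ * (6 * A₀) * ((R : ℝ) + 1) * (B + S') + d * (2 ^ d * C₂) * (4 * A₀) * (1 + Real.log ((R : ℝ) + 1)) * Gb := by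
    positivity
  by_cases hx : x ∈ cube c R
  swap
  · rw [hZ x hx, Pi.zero_apply, norm_zero]; exact hrhs0
  -- supports
  set T := cube c (R + 3) with hT
  have hxT : x ∈ T := cube_mono (by omega) hx
  have hx3 : x ∈ cube c (R + 2 + 1) := cube_mono (by omega) hx
  have hcurl0 : ∀ y, y ∉ cube c (R + 1) → ∀ μ ν, curlAt (flat (d := d) (n := n)) Z y μ ν = 0 :=
    fun y hy μ ν => curlAt_flat_eq_zero_off Z hZ hy μ ν
  have hdivZ0 : ∀ y, y ∉ cube c (R + 1) → flatDiv Z y = 0 := fun y hy => flatDiv_eq_zero_off Z hZ hy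
  have hdivg0 : ∀ y, y ∉ cube c (R + 2) → flatDiv g y = 0 := fun y hy => flatDiv_eq_zero_off g hg hy
  have hs0 : ∀ y, y ∉ cube c (R + 2) → s y = 0 := by
    intro y hy
    have h := hdiv y
    rw [hdivZ0 y (fun h' => hy (cube_mono (by omega) h')), hdivg0 y hy, zero_add] at h
    exact h.symm
  -- the two row sums seen from `x`
  have hrow : ∑ y ∈ T, 1 / nrm (x - y) ^ (d - 1) ≤ 6 * A₀ * ((R : ℝ) + 1) := by
    have h := sum_cube_inv_nrm_sub_le hd c x (R + 2) hx3
    have : (1 : ℝ) + 2 * d * 3 ^ (d - 1) * ((2 * (R + 2) + 2 : ℕ) : ℝ) ≤ 6 * A₀ * ((R : ℝ) + 1) := by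
      rw [hA₀]; push_cast; nlinarith [hA₀0, hR0]
    exact h.trans this
  have hrowlog : ∑ y ∈ T, 1 / nrm (x - y) ^ d ≤ 4 * A₀ * (1 + Real.log ((R : ℝ) + 1)) := by
    have h := sum_cube_inv_nrm_pow_d_sub_le hd c x (R + 3) hxT
    have h2 := one_add_posLog_two_mul_le R
    have hpl : 0 ≤ Real.posLog ((2 * (R + 3) : ℕ) : ℝ) := Real.posLog_nonneg
    calc ∑ y ∈ T, 1 / nrm (x - y) ^ d ≤ 1 + 2 * d * 3 ^ (d - 1) * (1 + Real.posLog ((2 * (R + 3) : ℕ) : ℝ)) := h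
      _ ≤ A₀ * (1 + Real.posLog ((2 * (R + 3) : ℕ) : ℝ)) := by rw [hA₀]; nlinarith
      _ ≤ A₀ * (4 * (1 + Real.log ((R : ℝ) + 1))) := mul_le_mul_of_nonneg_left h2 hA₀0
      _ = _ := by ring
  -- duality: bound every real functional of `Z x κ`
  set M : ℝ := (d + 1) * C₁ * (6 * A₀) * ((R : ℝ) + 1) * (B + S') + d * (2 ^ d * C₂) * (4 * A₀) * (1 + Real.log ((R : ℝ) + 1)) * Gb with hM
  refine NormedSpace.norm_le_dual_bound ℝ _ hrhs0 fun f => ?_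
  -- scalar data
  set cf : Fin d → Site d → ℝ := fun ν y => f (curlAt (flat (d := d) (n := n)) Z y ν κ) with hcf
  set gf : Fin d → Site d → ℝ := fun lam y => f (g y lam) with hgf
  set sf : Site d → ℝ := fun y => f (s y) with hsf
  set Df : Site d → ℝ := fun y => f (flatDiv Z y) with hDf
  have hcfb : ∀ ν y, |cf ν y| ≤ ‖f‖ * B := by
    intro ν y
    by_cases hν : ν = κ
    · subst hν; simp only [hcf, curlAt_flat_diag, map_zero, abs_zero]; positivity
    · exact (Real.norm_eq_abs _ ▸ f.le_opNorm _).trans (mul_le_mul_of_nonneg_left (hB y ν κ hν) (norm_nonneg _))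
  have hgfb : ∀ lam y, |gf lam y| ≤ ‖f‖ * Gb := fun lam y =>
    (Real.norm_eq_abs _ ▸ f.le_opNorm _).trans (mul_le_mul_of_nonneg_left (hGb y lam) (norm_nonneg _))
  have hsfb : ∀ y, |sf y| ≤ ‖f‖ * S' := fun y =>
    (Real.norm_eq_abs _ ▸ f.le_opNorm _).trans (mul_le_mul_of_nonneg_left (hs y) (norm_nonneg _))
  have hcf0 : ∀ ν y, y ∉ cube c (R + 1) → cf ν y = 0 := fun ν y hy => by simp only [hcf, hcurl0 y hy, map_zero]
  have hDf_eq : ∀ y, Df y = (∑ lam : Fin d, (gf lam y - gf lam (y - e lam))) + sf y := by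
    intro y
    simp only [hDf, hgf, hsf]
    rw [hdiv y, map_add]
    congr 1
    simp only [flatDiv, map_sum, map_sub]
  have hDf0 : ∀ y, y ∉ cube c (R + 2) → Df y = 0 := fun y hy => by
    simp only [hDf, hdivZ0 y (fun h' => hy (cube_mono (by omega) h')), map_zero]
  have hgf0 : ∀ lam y, y ∉ cube c (R + 1) → gf lam y = 0 := fun lam y hy => by simp only [hgf, hg y hy, Pi.zero_apply, map_zero]
  -- Green representation of `f ∘ Z_κ` on `T = cube c (R+2+1)`
  have hfg : ∀ y, y ∉ cube c (R + 2) → (fun z => f (Z z κ)) y = 0 := fun y hy => by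
    simp only [hZ y (fun h' => hy (cube_mono (by omega) h')), Pi.zero_apply, map_zero]
  have hrep : f (Z x κ) = -∑ y ∈ T, G₀ (x - y) * latticeLaplacianZd (fun z => f (Z z κ)) y := green_rep hd c (R + 2) _ hfg x
  -- the scalar Laplacian through the data
  have hlapf : ∀ y, latticeLaplacianZd (fun z => f (Z z κ)) y = (∑ ν : Fin d, (cf ν y - cf ν (y - e ν))) + (Df (y + e κ) - Df y) := by
    intro y
    rw [lap_dual_apply, lapVec_eq_curl_div, map_add, map_sum, map_sub]
    simp only [hcf, hDf, map_sub]
  -- membership helpers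
  have hmemT_of2 : ∀ y, y ∈ cube c (R + 2) → ∀ μ : Fin d, y - e μ ∈ T ∧ y + e μ ∈ T := fun y hy μ => sub_e_mem_cube_succ hy μ
  have hmemT_of1 : ∀ y, y ∈ cube c (R + 1) → ∀ μ : Fin d, y - e μ ∈ T ∧ y + e μ ∈ T := fun y hy μ =>
    ⟨cube_mono (by omega) (sub_e_mem_cube_succ hy μ).1, cube_mono (by omega) (sub_e_mem_cube_succ hy μ).2⟩
  -- (1) the curl part, summed by parts: `Σ_T G₀(x−y)(cf(y) − cf(y−e_ν)) = Σ_T [G₀(x−y) − G₀(x−y−e_ν)]·cf(y)`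
  have hcurl_sbp : ∀ ν : Fin d, ∑ y ∈ T, G₀ (x - y) * (cf ν y - cf ν (y - e ν)) = ∑ y ∈ T, (G₀ (x - y) - G₀ (x - y - e ν)) * cf ν y := by
    intro ν
    have hsh := sum_shift T (e ν) (fun y => G₀ (x - y) * cf ν (y - e ν)) ?_ ?_
    rotate_left
    · intro y hy
      have : cf ν (y - e ν) = 0 := hcf0 ν _ fun h => hy (by
        have h' := (sub_e_mem_cube_succ h ν).2; rw [sub_add_cancel] at h'; exact cube_mono (by omega) h')
      simp [this]
    · intro y hy
      have hne : cf ν (y - e ν) ≠ 0 := by intro h; apply hy; simp [h]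
      have hmem : y - e ν ∈ cube c (R + 1) := by by_contra h; exact hne (hcf0 ν _ h)
      exact cube_mono (by omega) hmem
    have hsh' : ∑ y ∈ T, G₀ (x - (y + e ν)) * cf ν y = ∑ y ∈ T, G₀ (x - y) * cf ν (y - e ν) := by
      simpa using hsh
    calc ∑ y ∈ T, G₀ (x - y) * (cf ν y - cf ν (y - e ν))
        = ∑ y ∈ T, G₀ (x - y) * cf ν y - ∑ y ∈ T, G₀ (x - y) * cf ν (y - e ν) := by
          rw [← Finset.sum_sub_distrib]; exact Finset.sum_congr rfl fun y _ => by ring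
      _ = ∑ y ∈ T, G₀ (x - y) * cf ν y - ∑ y ∈ T, G₀ (x - (y + e ν)) * cf ν y := by rw [hsh']
      _ = _ := by rw [← Finset.sum_sub_distrib]; exact Finset.sum_congr rfl fun y _ => by rw [show x - (y + e ν) = x - y - e ν by abel]; ring
  -- (2) the divergence part: `Σ_T G₀(x−y)(Df(y+e_κ) − Df(y)) = Σ_T [G₀(x−y+e_κ) − G₀(x−y)]·Df(y)`
  have hdiv_sbp : ∑ y ∈ T, G₀ (x - y) * (Df (y + e κ) - Df y) = ∑ y ∈ T, (G₀ (x - y + e κ) - G₀ (x - y)) * Df y := by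
    have hsh := sum_shift T (e κ) (fun y => G₀ (x - (y - e κ)) * Df y) ?_ ?_
    rotate_left
    · intro y hy
      have : Df y = 0 := hDf0 y fun h => hy (cube_mono (by omega) h)
      simp [this]
    · intro y hy
      have hne : Df y ≠ 0 := by intro h; apply hy; simp [h]
      have hmem : y ∈ cube c (R + 2) := by by_contra h; exact hne (hDf0 y h)
      exact (hmemT_of2 y hmem κ).1
    have hsh' : ∑ y ∈ T, G₀ (x - y) * Df (y + e κ) = ∑ y ∈ T, G₀ (x - (y - e κ)) * Df y := by
      simpa using hsh
    calc ∑ y ∈ T, G₀ (x - y) * (Df (y + e κ) - Df y)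
        = ∑ y ∈ T, G₀ (x - y) * Df (y + e κ) - ∑ y ∈ T, G₀ (x - y) * Df y := by
          rw [← Finset.sum_sub_distrib]; exact Finset.sum_congr rfl fun y _ => by ring
      _ = ∑ y ∈ T, G₀ (x - (y - e κ)) * Df y - ∑ y ∈ T, G₀ (x - y) * Df y := by rw [hsh']
      _ = _ := by rw [← Finset.sum_sub_distrib]; exact Finset.sum_congr rfl fun y _ => by rw [show x - (y - e κ) = x - y + e κ by abel]; ring
  -- (3) inside the divergence part, the `g` part summed by parts once more
  set dk : Site d → ℝ := fun y => G₀ (x - y + e κ) - G₀ (x - y) with hdk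
  have hg_sbp : ∀ lam : Fin d, ∑ y ∈ T, dk y * (gf lam y - gf lam (y - e lam)) = ∑ y ∈ T, (dk y - dk (y + e lam)) * gf lam y := by
    intro lam
    have hsh := sum_shift T (e lam) (fun y => dk y * gf lam (y - e lam)) ?_ ?_
    rotate_left
    · intro y hy
      have : gf lam (y - e lam) = 0 := hgf0 lam _ fun h => hy (by
        have h' := (sub_e_mem_cube_succ h lam).2; rw [sub_add_cancel] at h'; exact cube_mono (by omega) h')
      simp [this]
    · intro y hy
      have hne : gf lam (y - e lam) ≠ 0 := by intro h; apply hy; simp [h]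
      have hmem : y - e lam ∈ cube c (R + 1) := by by_contra h; exact hne (hgf0 lam _ h)
      exact cube_mono (by omega) hmem
    have hsh' : ∑ y ∈ T, dk (y + e lam) * gf lam y = ∑ y ∈ T, dk y * gf lam (y - e lam) := by
      simpa using hsh
    calc ∑ y ∈ T, dk y * (gf lam y - gf lam (y - e lam))
        = ∑ y ∈ T, dk y * gf lam y - ∑ y ∈ T, dk y * gf lam (y - e lam) := by
          rw [← Finset.sum_sub_distrib]; exact Finset.sum_congr rfl fun y _ => by ring
      _ = ∑ y ∈ T, dk y * gf lam y - ∑ y ∈ T, dk (y + e lam) * gf lam y := by rw [hsh']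
      _ = _ := by rw [← Finset.sum_sub_distrib]; exact Finset.sum_congr rfl fun y _ => by ring
  -- kernel bounds
  have hK1 : ∀ y (ν : Fin d), |G₀ (x - y) - G₀ (x - y - e ν)| ≤ C₁ / nrm (x - y) ^ (d - 1) := by
    intro y ν; rw [abs_sub_comm]; exact (hG1 (x - y) ν).2
  have hK1' : ∀ y, |dk y| ≤ C₁ / nrm (x - y) ^ (d - 1) := fun y => (hG1 (x - y) κ).1
  have hK2 : ∀ y (lam : Fin d), |dk y - dk (y + e lam)| ≤ 2 ^ d * C₂ / nrm (x - y) ^ d := by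
    intro y lam
    set v := x - y with hv
    have ew : x - (y + e lam) = v - e lam := by rw [hv]; abel
    have e1 : dk y - dk (y + e lam) = G₀ (v - e lam + e lam + e κ) - G₀ (v - e lam + e lam) - G₀ (v - e lam + e κ) + G₀ (v - e lam) := by
      simp only [hdk]; rw [ew, sub_add_cancel]; ring
    rw [e1]
    have h := hG2 (v - e lam) κ lam
    refine h.trans ?_
    have hhalf : nrm v / 2 ≤ nrm (v - e lam) := by
      rw [sub_eq_add_neg]; exact nrm_shift_ge_half v _ (by rw [supNorm_neg]; exact supNorm_single_one lam)
    have hpos := nrm_pos (v - e lam)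
    have hposv := nrm_pos v
    rw [div_le_div_iff₀ (pow_pos hpos d) (pow_pos hposv d)]
    calc C₂ * nrm v ^ d = C₂ * ((nrm v / 2) ^ d * 2 ^ d) := by rw [div_pow, div_mul_cancel₀ _ (by positivity)]
      _ ≤ C₂ * (nrm (v - e lam) ^ d * 2 ^ d) := by
          apply mul_le_mul_of_nonneg_left _ hC₂
          exact mul_le_mul_of_nonneg_right (pow_le_pow_left₀ (by positivity) hhalf d) (by positivity)
      _ = 2 ^ d * C₂ * nrm (v - e lam) ^ d := by ring
  -- the whole sum, rewritten
  have hsum : ∑ y ∈ T, G₀ (x - y) * latticeLaplacianZd (fun z => f (Z z κ)) y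
      = (∑ ν : Fin d, ∑ y ∈ T, (G₀ (x - y) - G₀ (x - y - e ν)) * cf ν y)
        + ((∑ lam : Fin d, ∑ y ∈ T, (dk y - dk (y + e lam)) * gf lam y) + ∑ y ∈ T, dk y * sf y) := by
    have e1 : ∑ y ∈ T, G₀ (x - y) * latticeLaplacianZd (fun z => f (Z z κ)) y
        = (∑ y ∈ T, ∑ ν : Fin d, G₀ (x - y) * (cf ν y - cf ν (y - e ν))) + ∑ y ∈ T, G₀ (x - y) * (Df (y + e κ) - Df y) := by
      rw [← Finset.sum_add_distrib]
      exact Finset.sum_congr rfl fun y _ => by rw [hlapf y, mul_add, Finset.mul_sum]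
    rw [e1, Finset.sum_comm, hdiv_sbp]
    congr 1
    · exact Finset.sum_congr rfl fun ν _ => hcurl_sbp ν
    · have e2 : ∑ y ∈ T, (G₀ (x - y + e κ) - G₀ (x - y)) * Df y = ∑ y ∈ T, (∑ lam : Fin d, dk y * (gf lam y - gf lam (y - e lam)) + dk y * sf y) := by
        refine Finset.sum_congr rfl fun y _ => ?_
        rw [hDf_eq y]; simp only [hdk]; rw [mul_add, Finset.mul_sum]
      rw [e2, Finset.sum_add_distrib, Finset.sum_comm]
      congr 1
      exact Finset.sum_congr rfl fun lam _ => hg_sbp lam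
  -- bounds of the three groups
  have hT0 : ∀ y, 0 ≤ 1 / nrm (x - y) ^ (d - 1) := fun y => by have := nrm_pos (x - y); positivity
  have hgroup1 : ∀ ν : Fin d, |∑ y ∈ T, (G₀ (x - y) - G₀ (x - y - e ν)) * cf ν y| ≤ C₁ * (‖f‖ * B) * (6 * A₀ * ((R : ℝ) + 1)) := by
    intro ν
    calc _ ≤ ∑ y ∈ T, |(G₀ (x - y) - G₀ (x - y - e ν)) * cf ν y| := Finset.abs_sum_le_sum_abs _ _
      _ ≤ ∑ y ∈ T, C₁ / nrm (x - y) ^ (d - 1) * (‖f‖ * B) := Finset.sum_le_sum fun y _ => by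
          rw [abs_mul]; exact mul_le_mul (hK1 y ν) (hcfb ν y) (abs_nonneg _) (by have := nrm_pos (x - y); positivity)
      _ = C₁ * (‖f‖ * B) * ∑ y ∈ T, 1 / nrm (x - y) ^ (d - 1) := by rw [Finset.mul_sum]; exact Finset.sum_congr rfl fun y _ => by ring
      _ ≤ _ := mul_le_mul_of_nonneg_left hrow (by positivity)
  have hgroup2 : ∀ lam : Fin d, |∑ y ∈ T, (dk y - dk (y + e lam)) * gf lam y| ≤ 2 ^ d * C₂ * (‖f‖ * Gb) * (4 * A₀ * (1 + Real.log ((R : ℝ) + 1))) := by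
    intro lam
    calc _ ≤ ∑ y ∈ T, |(dk y - dk (y + e lam)) * gf lam y| := Finset.abs_sum_le_sum_abs _ _
      _ ≤ ∑ y ∈ T, 2 ^ d * C₂ / nrm (x - y) ^ d * (‖f‖ * Gb) := Finset.sum_le_sum fun y _ => by
          rw [abs_mul]; exact mul_le_mul (hK2 y lam) (hgfb lam y) (abs_nonneg _) (by have := nrm_pos (x - y); positivity)
      _ = 2 ^ d * C₂ * (‖f‖ * Gb) * ∑ y ∈ T, 1 / nrm (x - y) ^ d := by rw [Finset.mul_sum]; exact Finset.sum_congr rfl fun y _ => by ring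
      _ ≤ _ := mul_le_mul_of_nonneg_left hrowlog (by positivity)
  have hgroup3 : |∑ y ∈ T, dk y * sf y| ≤ C₁ * (‖f‖ * S') * (6 * A₀ * ((R : ℝ) + 1)) := by
    calc _ ≤ ∑ y ∈ T, |dk y * sf y| := Finset.abs_sum_le_sum_abs _ _
      _ ≤ ∑ y ∈ T, C₁ / nrm (x - y) ^ (d - 1) * (‖f‖ * S') := Finset.sum_le_sum fun y _ => by
          rw [abs_mul]; exact mul_le_mul (hK1' y) (hsfb y) (abs_nonneg _) (by have := nrm_pos (x - y); positivity)
      _ = C₁ * (‖f‖ * S') * ∑ y ∈ T, 1 / nrm (x - y) ^ (d - 1) := by rw [Finset.mul_sum]; exact Finset.sum_congr rfl fun y _ => by ring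
      _ ≤ _ := mul_le_mul_of_nonneg_left hrow (by positivity)
  -- assemble
  rw [hrep, norm_neg, Real.norm_eq_abs, hsum]
  calc |(∑ ν : Fin d, ∑ y ∈ T, (G₀ (x - y) - G₀ (x - y - e ν)) * cf ν y)
        + ((∑ lam : Fin d, ∑ y ∈ T, (dk y - dk (y + e lam)) * gf lam y) + ∑ y ∈ T, dk y * sf y)|
      ≤ |∑ ν : Fin d, ∑ y ∈ T, (G₀ (x - y) - G₀ (x - y - e ν)) * cf ν y|
        + (|∑ lam : Fin d, ∑ y ∈ T, (dk y - dk (y + e lam)) * gf lam y| + |∑ y ∈ T, dk y * sf y|) :=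
        (abs_add_le _ _).trans (add_le_add le_rfl (abs_add_le _ _))
    _ ≤ (∑ _ν : Fin d, C₁ * (‖f‖ * B) * (6 * A₀ * ((R : ℝ) + 1)))
        + ((∑ _lam : Fin d, 2 ^ d * C₂ * (‖f‖ * Gb) * (4 * A₀ * (1 + Real.log ((R : ℝ) + 1)))) + C₁ * (‖f‖ * S') * (6 * A₀ * ((R : ℝ) + 1))) :=
        add_le_add ((Finset.abs_sum_le_sum_abs _ _).trans (Finset.sum_le_sum fun ν _ => hgroup1 ν))
          (add_le_add ((Finset.abs_sum_le_sum_abs _ _).trans (Finset.sum_le_sum fun lam _ => hgroup2 lam)) hgroup3)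
    _ = d * (C₁ * (‖f‖ * B) * (6 * A₀ * ((R : ℝ) + 1))) + (d * (2 ^ d * C₂ * (‖f‖ * Gb) * (4 * A₀ * (1 + Real.log ((R : ℝ) + 1)))) + C₁ * (‖f‖ * S') * (6 * A₀ * ((R : ℝ) + 1))) := by
        simp only [Finset.sum_const, Finset.card_univ, Fintype.card_fin, nsmul_eq_mul]
    _ ≤ M * ‖f‖ := by
        rw [hM]
        have hf0 : 0 ≤ ‖f‖ := norm_nonneg _
        have hS1 : C₁ * (‖f‖ * S') * (6 * A₀ * ((R : ℝ) + 1)) ≤ (d + 1) * C₁ * (6 * A₀) * ((R : ℝ) + 1) * S' * ‖f‖ := by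
          have : 0 ≤ C₁ * (‖f‖ * S') * (6 * A₀ * ((R : ℝ) + 1)) := by positivity
          nlinarith
        have hB1 : d * (C₁ * (‖f‖ * B) * (6 * A₀ * ((R : ℝ) + 1))) ≤ (d + 1) * C₁ * (6 * A₀) * ((R : ℝ) + 1) * B * ‖f‖ := by
          have : 0 ≤ C₁ * (‖f‖ * B) * (6 * A₀ * ((R : ℝ) + 1)) := by positivity
          nlinarith
        have hG1 : d * (2 ^ d * C₂ * (‖f‖ * Gb) * (4 * A₀ * (1 + Real.log ((R : ℝ) + 1)))) = d * (2 ^ d * C₂) * (4 * A₀) * (1 + Real.log ((R : ℝ) + 1)) * Gb * ‖f‖ := by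
          ring
        nlinarith

end

end Summit.QuantumFields.BalabanUV.T4Continuum.NE7FlatSupLetterCubeDivForm
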